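import Summits.AtomisticToContinuum.FouriersLaw.Theorems.PhononMeanFreePathCoherentDephasingStrictAbsorptionGeneratorAlgebra
import Summits.AtomisticToContinuum.FouriersLaw.Theorems.PhononMeanFreePathCoherentDephasingStrictAbsorptionGeneratorCubeAux

/-!
# `CoherentDephasing` / line `Sketch`, strict absorption: the third generator power `L G₂ = G₃`

Stub `sa_generatorCube` (sub-goal K4a' of the lead's `N`-uniform strict-absorption skeleton) of crux
`stmt-AtomisticToContinuum-11810` (`PhononMeanFreePath.CoherentDephasing`). For the `(N+1)`-site pinned
anharmonic chain `pinnedChain ω₂ lam β γ` (`N ≥ 2`, both baths at `T`) and the explicit polynomial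
`G₂ = L² p₀ = -p₀ Φ + p₁ (1 + 3β r²) + γ (U'(q₀) - V'(r)) + γ² p₀` (`r = q₁ - q₀`,
`Φ = U''(q₀) + V''(r) = ω₂ + 3 lam q₀² + 1 + 3β r²`) we compute `G₃ := L G₂` in closed form, a polynomial
of degree `5` in `q₀, q₁, q₂, p₀, p₁`:
`G₃ = p₀ ∂_{q₀}G₂ + p₁ ∂_{q₁}G₂ - ∂_{q₀}H ∂_{p₀}G₂ - ∂_{q₁}H ∂_{p₁}G₂ - γ p₀ ∂_{p₀}G₂`
(the bath at site `0` contributes `γ (T ∂²_{p₀} - p₀ ∂_{p₀}) G₂` with `∂²_{p₀} G₂ = 0`; the bath at site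
`N ≥ 2` does not see `G₂`; `∂_{q₁}H = U'(q₁) + V'(q₁ - q₀) - V'(q₂ - q₁)` brings in `q₂`). We prove
`L G₂ = G₃` pointwise (`genCube_generator`), `Continuous G₃`, the crude bound `|G₃| ≤ B (1 + H)³`, and the
`N`-UNIFORM local bound `|G₃ z| ≤ C₃ (1 + Σ_{i ≤ 2} (q_i⁶ + p_i⁶))` with `C₃ = C₃(ω₂, lam, β, γ)` (the
scalar inequality `genCube_polyBound` of the companion file `…GeneratorCubeAux`; the `(1 + H)³` bound follows
from `q_i⁶ ≤ (8/ω₂³) H³`, `p_i⁶ ≤ 8 H³`). All [folklore].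
-/

noncomputable section

open MeasureTheory ProbabilityTheory Filter Topology Set
open scoped NNReal ENNReal

namespace Summit.AtomisticToContinuum.FouriersLaw.Theorems.CoherentDephasing.StrictAbsorption

open Literature.MathematicalPhysics.KineticTheory.HeatConduction
open Literature.MathematicalPhysics.KineticTheory Literature.Probability.Process OscillatorChain
open Summit.AtomisticToContinuum.FouriersLaw.Theorems.CoherentDephasing.MeanFieldDuhamel

/-! ### Coordinate derivatives of `G₂` (generic sites `a ≠ b`) -/

section Derivs

variable {n : ℕ} (ω₂ lam β γ : ℝ) {a b : Fin n}

/-- `∂_{q_i} G₂ = [i = a] ∂_{q_a}G₂ + [i = b] ∂_{q_b}G₂` with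
`∂_{q_a}G₂ = -p_a (6 lam q_a - 6β r) - 6β r p_b + γ Φ`, `∂_{q_b}G₂ = -6β r p_a + 6β r p_b - γ (1 + 3β r²)`
(`r = q_b - q_a`), and `0` at every other site. [folklore] -/
theorem genCube_partialQ (hab : a ≠ b) {G : PhaseSpace n → ℝ}
    (hG : G = fun y : PhaseSpace n =>
      -(y.2 a * (ω₂ + 3 * lam * y.1 a ^ 2 + 1 + 3 * β * (y.1 b - y.1 a) ^ 2)) +
        y.2 b * (1 + 3 * β * (y.1 b - y.1 a) ^ 2) +
        γ * (ω₂ * y.1 a + lam * y.1 a ^ 3 - ((y.1 b - y.1 a) + β * (y.1 b - y.1 a) ^ 3)) + γ ^ 2 * y.2 a)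
    (i : Fin n) (x : PhaseSpace n) :
    partialQ i G x =
      (if i = a then
        -(x.2 a * (6 * lam * x.1 a - 6 * β * (x.1 b - x.1 a))) - x.2 b * (6 * β * (x.1 b - x.1 a)) +
          γ * (ω₂ + 3 * lam * x.1 a ^ 2 + 1 + 3 * β * (x.1 b - x.1 a) ^ 2)
        else 0) +
      (if i = b then
        -(x.2 a * (6 * β * (x.1 b - x.1 a))) + x.2 b * (6 * β * (x.1 b - x.1 a)) -
          γ * (1 + 3 * β * (x.1 b - x.1 a) ^ 2)
        else 0) := by
  subst hG
  -- one-variable derivatives of the eta-reduced pieces `t ↦ c - t`, `t ↦ c t` left over by `simp`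
  have hds : ∀ c t : ℝ, deriv (HSub.hSub c) t = -1 := fun c t => by
    rw [show HSub.hSub c = fun s => c - s from rfl, deriv_const_sub, deriv_id'']
  have hdm : ∀ c t : ℝ, deriv (HMul.hMul c) t = c := fun c t => by
    rw [show HMul.hMul c = fun s => c * s from rfl, deriv_const_mul_id]
  rcases eq_or_ne i a with rfl | hia
  · rw [if_pos rfl, if_neg hab, add_zero]
    unfold partialQ
    simp only [Function.update_self, Function.update_of_ne hab.symm]
    simp (disch := fun_prop) only [deriv_fun_add, deriv_fun_sub, deriv_fun_mul, deriv_fun_pow, deriv.fun_neg,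
      deriv_const, deriv_id'', hds, hdm, Nat.cast_ofNat]
    ring
  · rcases eq_or_ne i b with rfl | hib
    · rw [if_neg hia, if_pos rfl, zero_add]
      unfold partialQ
      simp only [Function.update_self, Function.update_of_ne hab]
      simp (disch := fun_prop) only [deriv_fun_add, deriv_fun_sub, deriv_fun_mul, deriv_fun_pow, deriv.fun_neg,
        deriv_const, deriv_id'', Nat.cast_ofNat]
      ring
    · rw [if_neg hia, if_neg hib, add_zero]
      unfold partialQ
      simp only [Function.update_of_ne (Ne.symm hia), Function.update_of_ne (Ne.symm hib), deriv_const]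

/-- `∂_{p_i} G₂ = [i = a] (-Φ + γ²) + [i = b] (1 + 3β r²)`. [folklore] -/
theorem genCube_partialP (hab : a ≠ b) {G : PhaseSpace n → ℝ}
    (hG : G = fun y : PhaseSpace n =>
      -(y.2 a * (ω₂ + 3 * lam * y.1 a ^ 2 + 1 + 3 * β * (y.1 b - y.1 a) ^ 2)) +
        y.2 b * (1 + 3 * β * (y.1 b - y.1 a) ^ 2) +
        γ * (ω₂ * y.1 a + lam * y.1 a ^ 3 - ((y.1 b - y.1 a) + β * (y.1 b - y.1 a) ^ 3)) + γ ^ 2 * y.2 a)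
    (i : Fin n) (x : PhaseSpace n) :
    partialP i G x =
      (if i = a then -(ω₂ + 3 * lam * x.1 a ^ 2 + 1 + 3 * β * (x.1 b - x.1 a) ^ 2) + γ ^ 2 else 0) +
      (if i = b then 1 + 3 * β * (x.1 b - x.1 a) ^ 2 else 0) := by
  subst hG
  have hdm : ∀ c t : ℝ, deriv (HMul.hMul c) t = c := fun c t => by
    rw [show HMul.hMul c = fun s => c * s from rfl, deriv_const_mul_id]
  rcases eq_or_ne i a with rfl | hia
  · rw [if_pos rfl, if_neg hab, add_zero]
    unfold partialP
    simp only [Function.update_self, Function.update_of_ne hab.symm]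
    simp (disch := fun_prop) only [deriv_fun_add, deriv_fun_sub, deriv_fun_mul, deriv_fun_pow, deriv.fun_neg,
      deriv_const, deriv_id'', hdm, Nat.cast_ofNat]
    ring
  · rcases eq_or_ne i b with rfl | hib
    · rw [if_neg hia, if_pos rfl, zero_add]
      unfold partialP
      simp only [Function.update_self, Function.update_of_ne hab]
      simp (disch := fun_prop) only [deriv_fun_add, deriv_fun_sub, deriv_fun_mul, deriv_fun_pow, deriv.fun_neg,
        deriv_const, deriv_id'', Nat.cast_ofNat]
      ring
    · rw [if_neg hia, if_neg hib, add_zero]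
      unfold partialP
      simp only [Function.update_of_ne (Ne.symm hia), Function.update_of_ne (Ne.symm hib), deriv_const]

/-- `∂²_{p_i} G₂ = 0` at every site (`G₂` is affine in the momenta). [folklore] -/
theorem genCube_partialPP (hab : a ≠ b) {G : PhaseSpace n → ℝ}
    (hG : G = fun y : PhaseSpace n =>
      -(y.2 a * (ω₂ + 3 * lam * y.1 a ^ 2 + 1 + 3 * β * (y.1 b - y.1 a) ^ 2)) +
        y.2 b * (1 + 3 * β * (y.1 b - y.1 a) ^ 2) +
        γ * (ω₂ * y.1 a + lam * y.1 a ^ 3 - ((y.1 b - y.1 a) + β * (y.1 b - y.1 a) ^ 3)) + γ ^ 2 * y.2 a)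
    (i : Fin n) (x : PhaseSpace n) :
    partialP i (partialP i G) x = 0 := by
  have h : partialP i G = fun x : PhaseSpace n =>
      (if i = a then -(ω₂ + 3 * lam * x.1 a ^ 2 + 1 + 3 * β * (x.1 b - x.1 a) ^ 2) + γ ^ 2 else 0) +
      (if i = b then 1 + 3 * β * (x.1 b - x.1 a) ^ 2 else 0) :=
    funext fun x => genCube_partialP ω₂ lam β γ hab hG i x
  rw [h]
  unfold partialP
  simp only [deriv_const]

end Derivs

/-! ### The force `∂_{q_1}H` of the `(N+1)`-site pinned chain (`∂_{q_0}H` is `genAlg_dPotential_zero`) -/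

/-- `∂_{q_1} H = U'(q₁) + V'(q₁ - q₀) - V'(q₂ - q₁)` for the pinned chain with at least three sites.
[folklore] -/
theorem genCube_dPotential_one (ω₂ lam β γ : ℝ) {N : ℕ} (hN : 2 ≤ N) (q : Fin (N + 1) → ℝ) :
    (pinnedChain ω₂ lam β γ).dPotential (N + 1) ⟨1, by omega⟩ q =
      ω₂ * q ⟨1, by omega⟩ + lam * q ⟨1, by omega⟩ ^ 3 -
        (((q ⟨2, by omega⟩ - q ⟨1, by omega⟩) + β * (q ⟨2, by omega⟩ - q ⟨1, by omega⟩) ^ 3) -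
          ((q ⟨1, by omega⟩ - q 0) + β * (q ⟨1, by omega⟩ - q 0) ^ 3)) := by
  rw [pinnedChain_dPotential_succ]
  congr 1
  rw [Finset.sum_sub_distrib]
  congr 1
  · rw [Finset.sum_eq_single (⟨1, by omega⟩ : Fin N)]
    · simp
    · intro b _ hb
      have hb1 : (b : ℕ) ≠ 1 := fun h => hb (Fin.ext h)
      simp [hb1]
    · simp
  · rw [Finset.sum_eq_single (⟨0, by omega⟩ : Fin N)]
    · simp
    · intro b _ hb
      have hb0 : (b : ℕ) ≠ 0 := fun h => hb (Fin.ext h)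
      simp [hb0]
    · simp

/-! ### The closed form `L G₂ = G₃` -/

/-- **`L G₂ = G₃` explicitly** for the `(N+1)`-site pinned chain (`N ≥ 2`, both baths at `T`):
`G₃ = p₀ ∂_{q₀}G₂ + p₁ ∂_{q₁}G₂ - ∂_{q₀}H ∂_{p₀}G₂ - ∂_{q₁}H ∂_{p₁}G₂ - γ p₀ ∂_{p₀}G₂`, a polynomial of
degree `5` in `q₀, q₁, q₂, p₀, p₁`. [folklore] -/
theorem genCube_generator (ω₂ lam β γ T : ℝ) {N : ℕ} (hN : 2 ≤ N) {G : PhaseSpace (N + 1) → ℝ}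
    (hG : G = fun y : PhaseSpace (N + 1) =>
      -(y.2 0 * (ω₂ + 3 * lam * y.1 0 ^ 2 + 1 + 3 * β * (y.1 ⟨1, by omega⟩ - y.1 0) ^ 2)) +
        y.2 ⟨1, by omega⟩ * (1 + 3 * β * (y.1 ⟨1, by omega⟩ - y.1 0) ^ 2) +
        γ * (ω₂ * y.1 0 + lam * y.1 0 ^ 3 - ((y.1 ⟨1, by omega⟩ - y.1 0) + β * (y.1 ⟨1, by omega⟩ - y.1 0) ^ 3)) +
        γ ^ 2 * y.2 0)
    (x : PhaseSpace (N + 1)) :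
    (pinnedChain ω₂ lam β γ).generator (N + 1) T T G x =
      x.2 0 * (-(x.2 0 * (6 * lam * x.1 0 - 6 * β * (x.1 ⟨1, by omega⟩ - x.1 0))) -
          x.2 ⟨1, by omega⟩ * (6 * β * (x.1 ⟨1, by omega⟩ - x.1 0)) +
          γ * (ω₂ + 3 * lam * x.1 0 ^ 2 + 1 + 3 * β * (x.1 ⟨1, by omega⟩ - x.1 0) ^ 2)) +
        x.2 ⟨1, by omega⟩ * (-(x.2 0 * (6 * β * (x.1 ⟨1, by omega⟩ - x.1 0))) +
          x.2 ⟨1, by omega⟩ * (6 * β * (x.1 ⟨1, by omega⟩ - x.1 0)) -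
          γ * (1 + 3 * β * (x.1 ⟨1, by omega⟩ - x.1 0) ^ 2)) -
        (ω₂ * x.1 0 + lam * x.1 0 ^ 3 - ((x.1 ⟨1, by omega⟩ - x.1 0) + β * (x.1 ⟨1, by omega⟩ - x.1 0) ^ 3)) *
          (-(ω₂ + 3 * lam * x.1 0 ^ 2 + 1 + 3 * β * (x.1 ⟨1, by omega⟩ - x.1 0) ^ 2) + γ ^ 2) -
        (ω₂ * x.1 ⟨1, by omega⟩ + lam * x.1 ⟨1, by omega⟩ ^ 3 -
            (((x.1 ⟨2, by omega⟩ - x.1 ⟨1, by omega⟩) + β * (x.1 ⟨2, by omega⟩ - x.1 ⟨1, by omega⟩) ^ 3) -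
              ((x.1 ⟨1, by omega⟩ - x.1 0) + β * (x.1 ⟨1, by omega⟩ - x.1 0) ^ 3))) *
          (1 + 3 * β * (x.1 ⟨1, by omega⟩ - x.1 0) ^ 2) -
        γ * (x.2 0 * (-(ω₂ + 3 * lam * x.1 0 ^ 2 + 1 + 3 * β * (x.1 ⟨1, by omega⟩ - x.1 0) ^ 2) + γ ^ 2)) := by
  have h01 : (0 : Fin (N + 1)) ≠ ⟨1, by omega⟩ := fun h => absurd (congrArg Fin.val h) (by simp)
  have hQ := genCube_partialQ ω₂ lam β γ h01 hG
  have hP := genCube_partialP ω₂ lam β γ h01 hG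
  have hPP := genCube_partialPP ω₂ lam β γ h01 hG
  have hU : Differentiable ℝ (pinnedChain ω₂ lam β γ).U :=
    (pinnedChain_contDiff_U ω₂ lam β γ (n := 1)).differentiable one_ne_zero
  have hV : Differentiable ℝ (pinnedChain ω₂ lam β γ).V :=
    (pinnedChain_contDiff_V ω₂ lam β γ (n := 1)).differentiable one_ne_zero
  have hγ' : (pinnedChain ω₂ lam β γ).γ = γ := rfl
  -- the derivatives at the two active sites
  have hQ0 := hQ 0 x
  have hQ1 := hQ ⟨1, by omega⟩ x
  have hP0 := hP 0 x
  have hP1 := hP ⟨1, by omega⟩ x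
  rw [if_pos (rfl : (0 : Fin (N + 1)) = 0), if_neg h01, add_zero] at hQ0 hP0
  rw [if_neg h01.symm, if_pos (rfl : (⟨1, by omega⟩ : Fin (N + 1)) = ⟨1, by omega⟩), zero_add] at hQ1 hP1
  -- no other site contributes to the Hamiltonian part
  have hrest : ∀ i : Fin (N + 1), i ≠ 0 ∧ i ≠ ⟨1, by omega⟩ →
      x.2 i * partialQ i G x - partialQ i ((pinnedChain ω₂ lam β γ).hamiltonian (N + 1)) x * partialP i G x =
        0 := by
    intro i hi
    rw [hQ, hP, if_neg hi.1, if_neg hi.2, if_neg hi.1, if_neg hi.2]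
    ring
  -- only the bath at site `0` acts (`∂_{p_N} G₂ = 0` since `N ≥ 2`)
  have hbath : ∀ i ∈ (Finset.univ : Finset (Fin (N + 1))), i ≠ 0 →
      ((if i.val = 0 then T * partialP i (partialP i G) x - x.2 i * partialP i G x else 0) +
        (if i.val = N + 1 - 1 then T * partialP i (partialP i G) x - x.2 i * partialP i G x else 0)) = 0 := by
    intro i _ hi
    have hi0 : (i : ℕ) ≠ 0 := fun h => hi (Fin.ext (by rw [h]; simp))
    rw [if_neg hi0, zero_add]
    split_ifs with hiN
    · have hi1 : i ≠ ⟨1, by omega⟩ := fun h => by rw [h] at hiN; simp at hiN; omega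
      rw [hPP, hP, if_neg hi, if_neg hi1]
      ring
    · rfl
  have h00 : ((0 : Fin (N + 1)) : ℕ) = 0 := by simp
  have h0N : ((0 : Fin (N + 1)) : ℕ) ≠ N + 1 - 1 := by simp; omega
  unfold OscillatorChain.generator
  rw [Fintype.sum_eq_add 0 ⟨1, by omega⟩ h01 hrest,
    Finset.sum_eq_single (0 : Fin (N + 1)) hbath (fun h => absurd (Finset.mem_univ _) h),
    if_pos h00, if_neg h0N, add_zero, hPP, hQ0, hQ1, hP0, hP1,
    partialQ_hamiltonian_eq_dPotential _ hU hV, partialQ_hamiltonian_eq_dPotential _ hU hV,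
    genAlg_dPotential_zero ω₂ lam β γ (by omega : 1 ≤ N), genCube_dPotential_one ω₂ lam β γ hN, hγ']
  ring

/-! ### The registered stub -/

/-- **Stub `sa_generatorCube` (sub-goal K4a' of strict absorption, line `Sketch`, crux
`PhononMeanFreePath.CoherentDephasing`).** Third generator power at the kicked site of the `(N+1)`-site pinned
anharmonic chain with both baths at `T`: `L G₂ = G₃` for an explicit continuous polynomial `G₃` (degree `5` in
`q₀, q₁, q₂, p₀, p₁`) with the crude bound `|G₃| ≤ B (1+H)³` and the `N`-uniform local bound
`|G₃ z| ≤ C₃ (1 + Σ_{i ≤ 2} (q_i⁶ + p_i⁶))`, `C₃ = C₃(ω₂, lam, β, γ)`. [folklore] -/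
theorem sa_generatorCube :
    ∀ ω₂ lam β γ : ℝ, 0 < ω₂ → 0 < lam → 0 < β → 0 < γ → ∀ T : ℝ, 0 < T → ∃ C₃ : ℝ, ∀ (N : ℕ) (hN : 2 ≤ N), ∃ G₃ : PhaseSpace (N + 1) → ℝ, Continuous G₃ ∧ (∀ z : PhaseSpace (N + 1), (pinnedChain ω₂ lam β γ).generator (N + 1) T T (fun y : PhaseSpace (N + 1) => (-(y.2 0 * (ω₂ + 3 * lam * y.1 0 ^ 2 + 1 + 3 * β * (y.1 ⟨1, by omega⟩ - y.1 0) ^ 2)) + y.2 ⟨1, by omega⟩ * (1 + 3 * β * (y.1 ⟨1, by omega⟩ - y.1 0) ^ 2) + γ * (ω₂ * y.1 0 + lam * y.1 0 ^ 3 - ((y.1 ⟨1, by omega⟩ - y.1 0) + β * (y.1 ⟨1, by omega⟩ - y.1 0) ^ 3)) + γ ^ 2 * y.2 0)) z = G₃ z) ∧ (∃ B : ℝ, ∀ z, |G₃ z| ≤ B * (1 + (pinnedChain ω₂ lam β γ).hamiltonian (N + 1) z) ^ 3) ∧ (∀ z, |G₃ z| ≤ C₃ * (1 + ∑ i : Fin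 (N + 1), if (i : ℕ) ≤ 2 then z.1 i ^ 6 + z.2 i ^ 6 else 0)) := by
  intro ω₂ lam β γ hω hl hβ hγ T _hT
  obtain ⟨C, hC0, hC⟩ := genCube_polyBound hω.le hl.le hβ.le hγ.le
  refine ⟨3 * C, fun N hN => ?_⟩
  set G₃ : PhaseSpace (N + 1) → ℝ := fun x =>
    x.2 0 * (-(x.2 0 * (6 * lam * x.1 0 - 6 * β * (x.1 ⟨1, by omega⟩ - x.1 0))) -
        x.2 ⟨1, by omega⟩ * (6 * β * (x.1 ⟨1, by omega⟩ - x.1 0)) +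
        γ * (ω₂ + 3 * lam * x.1 0 ^ 2 + 1 + 3 * β * (x.1 ⟨1, by omega⟩ - x.1 0) ^ 2)) +
      x.2 ⟨1, by omega⟩ * (-(x.2 0 * (6 * β * (x.1 ⟨1, by omega⟩ - x.1 0))) +
        x.2 ⟨1, by omega⟩ * (6 * β * (x.1 ⟨1, by omega⟩ - x.1 0)) -
        γ * (1 + 3 * β * (x.1 ⟨1, by omega⟩ - x.1 0) ^ 2)) -
      (ω₂ * x.1 0 + lam * x.1 0 ^ 3 - ((x.1 ⟨1, by omega⟩ - x.1 0) + β * (x.1 ⟨1, by omega⟩ - x.1 0) ^ 3)) *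
        (-(ω₂ + 3 * lam * x.1 0 ^ 2 + 1 + 3 * β * (x.1 ⟨1, by omega⟩ - x.1 0) ^ 2) + γ ^ 2) -
      (ω₂ * x.1 ⟨1, by omega⟩ + lam * x.1 ⟨1, by omega⟩ ^ 3 -
          (((x.1 ⟨2, by omega⟩ - x.1 ⟨1, by omega⟩) + β * (x.1 ⟨2, by omega⟩ - x.1 ⟨1, by omega⟩) ^ 3) -
            ((x.1 ⟨1, by omega⟩ - x.1 0) + β * (x.1 ⟨1, by omega⟩ - x.1 0) ^ 3))) *
        (1 + 3 * β * (x.1 ⟨1, by omega⟩ - x.1 0) ^ 2) -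
      γ * (x.2 0 * (-(ω₂ + 3 * lam * x.1 0 ^ 2 + 1 + 3 * β * (x.1 ⟨1, by omega⟩ - x.1 0) ^ 2) + γ ^ 2)) with hG₃
  have hH0 : ∀ z, 0 ≤ (pinnedChain ω₂ lam β γ).hamiltonian (N + 1) z := fun z =>
    pinnedChain_hamiltonian_nonneg hω.le hl.le hβ.le γ (N + 1) z
  -- the `N`-uniform local bound
  have hS0 : ∀ (z : PhaseSpace (N + 1)) (i : Fin (N + 1)),
      0 ≤ (if (i : ℕ) ≤ 2 then z.1 i ^ 6 + z.2 i ^ 6 else 0) := fun z i => by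
    split_ifs <;> positivity
  have hloc : ∀ z, |G₃ z| ≤ 3 * C * (1 + ∑ i : Fin (N + 1), if (i : ℕ) ≤ 2 then z.1 i ^ 6 + z.2 i ^ 6 else 0) := by
    intro z
    have h := hC (z.1 0) (z.1 ⟨1, by omega⟩) (z.1 ⟨2, by omega⟩) (z.2 0) (z.2 ⟨1, by omega⟩)
    have e0 := Finset.single_le_sum (f := fun i : Fin (N + 1) => if (i : ℕ) ≤ 2 then z.1 i ^ 6 + z.2 i ^ 6 else 0)
      (fun i _ => hS0 z i) (Finset.mem_univ (0 : Fin (N + 1)))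
    have e1 := Finset.single_le_sum (f := fun i : Fin (N + 1) => if (i : ℕ) ≤ 2 then z.1 i ^ 6 + z.2 i ^ 6 else 0)
      (fun i _ => hS0 z i) (Finset.mem_univ (⟨1, by omega⟩ : Fin (N + 1)))
    have e2 := Finset.single_le_sum (f := fun i : Fin (N + 1) => if (i : ℕ) ≤ 2 then z.1 i ^ 6 + z.2 i ^ 6 else 0)
      (fun i _ => hS0 z i) (Finset.mem_univ (⟨2, by omega⟩ : Fin (N + 1)))
    rw [if_pos (by simp)] at e0 e1 e2
    have hp2 : 0 ≤ z.2 ⟨2, by omega⟩ ^ 6 := by positivity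
    have hsum := Finset.sum_nonneg fun i (_ : i ∈ (Finset.univ : Finset (Fin (N + 1)))) => hS0 z i
    refine h.trans ?_
    have key : 1 + (z.1 0 ^ 6 + z.2 0 ^ 6) + (z.1 ⟨1, by omega⟩ ^ 6 + z.2 ⟨1, by omega⟩ ^ 6) + z.1 ⟨2, by omega⟩ ^ 6 ≤
        3 * (1 + ∑ i : Fin (N + 1), if (i : ℕ) ≤ 2 then z.1 i ^ 6 + z.2 i ^ 6 else 0) := by linarith
    calc _ ≤ C * (3 * (1 + ∑ i : Fin (N + 1), if (i : ℕ) ≤ 2 then z.1 i ^ 6 + z.2 i ^ 6 else 0)) :=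
          mul_le_mul_of_nonneg_left key hC0
      _ = _ := by ring
  refine ⟨G₃, ?_, fun z => genCube_generator ω₂ lam β γ T hN rfl z, ?_, hloc⟩
  · -- continuity
    rw [hG₃]
    fun_prop
  · -- the crude `(1 + H)³` bound: `q_i⁶ ≤ (8/ω₂³) H³`, `p_i⁶ ≤ 8 H³`
    refine ⟨3 * C * (1 + (N + 1) * (8 / ω₂ ^ 3 + 8)), fun z => ?_⟩
    have hz := hH0 z
    have hU0 : ∀ q, 0 ≤ (pinnedChain ω₂ lam β γ).U q := fun q => by
      show 0 ≤ ω₂ * q ^ 2 / 2 + lam * q ^ 4 / 4; positivity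
    have hV0 : ∀ r, 0 ≤ (pinnedChain ω₂ lam β γ).V r := fun r => by
      show 0 ≤ r ^ 2 / 2 + β * r ^ 4 / 4; positivity
    have hsite : ∀ i : Fin (N + 1), (if (i : ℕ) ≤ 2 then z.1 i ^ 6 + z.2 i ^ 6 else 0) ≤
        (8 / ω₂ ^ 3 + 8) * (1 + (pinnedChain ω₂ lam β γ).hamiltonian (N + 1) z) ^ 3 := by
      intro i
      have hU := pinnedChain_U_le_hamiltonian hω.le hl.le hβ.le γ (N + 1) z i
      have hp := (pinnedChain ω₂ lam β γ).site_le_hamiltonian hU0 hV0 (N + 1) z i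
      have hUq := hU0 (z.1 i)
      set H := (pinnedChain ω₂ lam β γ).hamiltonian (N + 1) z with hH
      have hq2 : z.1 i ^ 2 ≤ 2 / ω₂ * H := by
        rw [div_mul_eq_mul_div, le_div_iff₀ hω]
        nlinarith [mul_nonneg hl.le (by positivity : (0 : ℝ) ≤ z.1 i ^ 4)]
      have hp2 : z.2 i ^ 2 ≤ 2 * H := by linarith
      have hq6 : z.1 i ^ 6 ≤ (2 / ω₂ * H) ^ 3 := by
        rw [show z.1 i ^ 6 = (z.1 i ^ 2) ^ 3 by ring]
        exact pow_le_pow_left₀ (sq_nonneg _) hq2 3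
      have hp6 : z.2 i ^ 6 ≤ (2 * H) ^ 3 := by
        rw [show z.2 i ^ 6 = (z.2 i ^ 2) ^ 3 by ring]
        exact pow_le_pow_left₀ (sq_nonneg _) hp2 3
      have hH3 : H ^ 3 ≤ (1 + H) ^ 3 := pow_le_pow_left₀ hz (by linarith) 3
      have e1 : (2 / ω₂ * H) ^ 3 = 8 / ω₂ ^ 3 * H ^ 3 := by ring
      have e2 : (2 * H) ^ 3 = 8 * H ^ 3 := by ring
      have h8 : (0 : ℝ) ≤ 8 / ω₂ ^ 3 := by positivity
      have h9 := mul_le_mul_of_nonneg_left hH3 h8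
      split_ifs
      · rw [e1] at hq6
        rw [e2] at hp6
        nlinarith
      · positivity
    have hS : (∑ i : Fin (N + 1), if (i : ℕ) ≤ 2 then z.1 i ^ 6 + z.2 i ^ 6 else 0) ≤
        (N + 1) * ((8 / ω₂ ^ 3 + 8) * (1 + (pinnedChain ω₂ lam β γ).hamiltonian (N + 1) z) ^ 3) := by
      calc _ ≤ ∑ _i : Fin (N + 1), (8 / ω₂ ^ 3 + 8) * (1 + (pinnedChain ω₂ lam β γ).hamiltonian (N + 1) z) ^ 3 :=
            Finset.sum_le_sum fun i _ => hsite i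
        _ = _ := by
            rw [Finset.sum_const, Finset.card_univ, Fintype.card_fin, nsmul_eq_mul]
            push_cast
            ring
    have h1 : (1 : ℝ) ≤ (1 + (pinnedChain ω₂ lam β γ).hamiltonian (N + 1) z) ^ 3 := one_le_pow₀ (by linarith)
    have hC3 : 0 ≤ 3 * C := by positivity
    calc |G₃ z| ≤ 3 * C * (1 + ∑ i : Fin (N + 1), if (i : ℕ) ≤ 2 then z.1 i ^ 6 + z.2 i ^ 6 else 0) := hloc z
      _ ≤ 3 * C * ((1 + (pinnedChain ω₂ lam β γ).hamiltonian (N + 1) z) ^ 3 +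
            (N + 1) * ((8 / ω₂ ^ 3 + 8) * (1 + (pinnedChain ω₂ lam β γ).hamiltonian (N + 1) z) ^ 3)) :=
          mul_le_mul_of_nonneg_left (add_le_add h1 hS) hC3
      _ = 3 * C * (1 + (N + 1) * (8 / ω₂ ^ 3 + 8)) * (1 + (pinnedChain ω₂ lam β γ).hamiltonian (N + 1) z) ^ 3 := by
          ring

end Summit.AtomisticToContinuum.FouriersLaw.Theorems.CoherentDephasing.StrictAbsorption

end
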